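import Mathlib
import Summits.Langlands.Langlands.Theorems.PhantomRMYoshidaStableYoshidaCongruenceResidualLatticeFrame
import HarnessLib

/-!
# Route `PhantomRMYoshida`, crux `StableYoshidaCongruence` (stmt-Langlands-13640), line
# `serre-dual-ribet-square`: Stub 3a, part Frame — an integral basis adapted to a subspace

Helper for the lead's stub `stub_invariantSubspaceFinrankTwo` (3a).  Let `O ⊆ F` be a valuation subring
of a field, `P ∈ GLₙ(F)` (the basis of a stable lattice `L = P·Oⁿ` handed out by
`exists_integralModel_of_valuationSubring`) and `W ⊆ Fⁿ` a subspace of dimension `m`.  We produce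
`A ∈ GLₙ(O)` — a change of `O`-basis of the SAME lattice — such that the first `m` columns of `Q = P·A`
lie in `W` (`exists_GL_adapted_submodule`); they are then an `F`-basis of `W`, so `L ∩ W` is the direct
summand of `L` spanned by the first `m` basis vectors, and a representation stabilising `L` and `W` is
block upper triangular in the basis `Q`.  This generalises the sibling line's `exists_GL_adapted_flag`
(the flag `F e₀ ⊂ F e₀ ⊕ F e₁`) to an arbitrary subspace, by induction on the number of adapted columns
and with the same two elementary tools (`exists_inv_mul_mem_valuationSubring`: a non-zero vector scales
into `Oⁿ` with a unit coordinate; `exists_GL_mulVec_single_eq`: such a vector is a column of a matrix of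
`GLₙ(O)` fixing the other standard vectors).  No module theory is needed; everything is proved.

References: Bourbaki, *Algèbre commutative* VI § 3 n° 6, Lemme 1 (finitely generated torsion-free
modules over valuation rings are free — the statement made elementary here); Serre, *Abelian ℓ-adic
representations* (1968), Ch. I §1.1.
-/

-- `Summit.Langlands.Langlands.…` (summit = sub-problem name, D-0017 layout) trips `dupNamespace` on every decl.
set_option linter.dupNamespace false

noncomputable section

open Module Matrix
open Summit.Langlands.Langlands.Cruxes.StableYoshidaCongruence.BurkhardtWeddleTwoThreeAnchor
  (exists_inv_mul_mem_valuationSubring exists_GL_mulVec_single_eq map_subtype_mulVec_coe coe_single)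

namespace Summit.Langlands.Langlands.Cruxes.StableYoshidaCongruence.SerreDualRibetSquare

/-! ## Coordinate subspaces -/

/-- A vector supported on a set of indices whose standard vectors lie in a submodule `S ⊆ Rⁿ` lies in
`S`. [folklore] -/
theorem mem_of_single_mem {R : Type*} [Semiring R] {n : ℕ} (S : Submodule R (Fin n → R))
    (p : Fin n → Prop) (hS : ∀ j, p j → (Pi.single j (1 : R) : Fin n → R) ∈ S) (v : Fin n → R)
    (hv : ∀ j, ¬ p j → v j = 0) : v ∈ S := by
  classical
  rw [← Finset.univ_sum_single v]
  refine Submodule.sum_mem _ fun j _ => ?_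
  by_cases hj : p j
  · have h1 : (Pi.single j (v j) : Fin n → R) = v j • (Pi.single j (1 : R) : Fin n → R) := by
      rw [← Pi.single_smul, smul_eq_mul, mul_one]
    rw [h1]
    exact S.smul_mem _ (hS j hj)
  · rw [hv j hj, Pi.single_zero]
    exact S.zero_mem

/-- Truncation to the first `m` coordinates, restricted to a submodule (unfolding lemma). [folklore] -/
theorem truncation_apply {R : Type*} [CommSemiring R] {n m : ℕ} (hmn : m ≤ n)
    (S : Submodule R (Fin n → R)) (x : S) (i : Fin m) :
    ((LinearMap.funLeft R R (Fin.castLE hmn)).comp S.subtype) x i = (x : Fin n → R) (Fin.castLE hmn i) :=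
  rfl

/-- If a subspace `S ⊆ Fⁿ` of dimension `> m` contains the first `m` standard vectors, some vector of `S`
has a non-zero coordinate beyond `m` (otherwise the truncation `S → Fᵐ` is injective). [folklore] -/
theorem exists_mem_apply_ne_zero_of_lt_finrank {F : Type*} [Field F] {n m : ℕ} (hmn : m ≤ n)
    (S : Submodule F (Fin n → F)) (hS : m < finrank F S) :
    ∃ x ∈ S, ∃ i : Fin n, m ≤ (i : ℕ) ∧ x i ≠ 0 := by
  classical
  by_contra hcon
  push Not at hcon
  set π : S →ₗ[F] (Fin m → F) := (LinearMap.funLeft F F (Fin.castLE hmn)).comp S.subtype with hπ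
  have hinj : Function.Injective π := by
    intro x y hxy
    apply Subtype.ext
    funext i
    by_cases hi : (i : ℕ) < m
    · have h1 := congr_fun hxy ⟨i, hi⟩
      rw [hπ, truncation_apply, truncation_apply] at h1
      simpa [Fin.castLE] using h1
    · rw [hcon x x.2 i (not_lt.mp hi), hcon y y.2 i (not_lt.mp hi)]
  have h2 := LinearMap.finrank_le_finrank_of_injective hinj
  rw [finrank_fin_fun] at h2
  omega

/-- Pulling back a subspace of `Fⁿ` along an invertible matrix preserves the dimension. [folklore] -/
theorem finrank_comap_toLin'_units {F : Type*} [Field F] {n : ℕ} (Q : GL (Fin n) F)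
    (W : Submodule F (Fin n → F)) :
    finrank F (W.comap (Matrix.toLin' (Q : Matrix (Fin n) (Fin n) F))) = finrank F W := by
  let e : (Fin n → F) ≃ₗ[F] (Fin n → F) :=
    LinearEquiv.ofLinear (Matrix.toLin' (Q : Matrix (Fin n) (Fin n) F))
      (Matrix.toLin' ((Q⁻¹ : GL (Fin n) F) : Matrix (Fin n) (Fin n) F))
      (by rw [← Matrix.toLin'_mul, ← Units.val_mul, mul_inv_cancel, Units.val_one, Matrix.toLin'_one])
      (by rw [← Matrix.toLin'_mul, ← Units.val_mul, inv_mul_cancel, Units.val_one, Matrix.toLin'_one])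
  exact (LinearEquiv.ofSubmodule' e W).finrank_eq

/-! ## An integral basis adapted to a subspace -/

/-- **An integral change of basis adapted to a subspace.**  For a valuation subring `O ⊆ F` of a field,
`P ∈ GLₙ(F)` and a subspace `W ⊆ Fⁿ` of dimension `m`, there is `A ∈ GLₙ(O)` such that the first `m`
columns of `Q = P·A` lie in (hence form a basis of) `W`: the lattice `P·Oⁿ = Q·Oⁿ` has an `O`-basis whose
first `m` vectors span `W`, i.e. `(P·Oⁿ) ∩ W` is a direct summand.  Induction on the number of adapted
columns: a vector of `Q⁻¹W` with a non-zero coordinate beyond the adapted ones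
(`exists_mem_apply_ne_zero_of_lt_finrank`), those coordinates killed, scaled to be `O`-integral with a
unit coordinate (`exists_inv_mul_mem_valuationSubring`), is the next column of a matrix of `GLₙ(O)` fixing
the adapted standard vectors (`exists_GL_mulVec_single_eq`).  Bourbaki, *Algèbre commutative* VI § 3
n° 6, Lemme 1 (finitely generated torsion-free modules over a valuation ring are free), made elementary.
[cite: SerreAbelianLadic1968, Ch. I §1.1, Remark 1] -/
theorem exists_GL_adapted_submodule :
    ∀ {F : Type*} [Field F] (O : ValuationSubring F) {n : ℕ} (P : GL (Fin n) F)
      (W : Submodule F (Fin n → F)),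
      ∃ A : GL (Fin n) O, ∀ j : Fin n, (j : ℕ) < Module.finrank F W →
        ((P : Matrix (Fin n) (Fin n) F) * (A : Matrix (Fin n) (Fin n) O).map O.subtype) *ᵥ
          Pi.single j 1 ∈ W := by
  intro F _ O n P W
  classical
  suffices H : ∀ m ≤ finrank F W, ∃ A : GL (Fin n) O, ∀ j : Fin n, (j : ℕ) < m →
      ((P : Matrix (Fin n) (Fin n) F) * (A : Matrix (Fin n) (Fin n) O).map O.subtype) *ᵥ
        Pi.single j 1 ∈ W from H _ le_rfl
  intro m
  induction m with
  | zero => exact fun _ => ⟨1, fun j hj => absurd hj (Nat.not_lt_zero _)⟩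
  | succ m ih =>
    intro hm
    obtain ⟨A, hA⟩ := ih (Nat.le_of_succ_le hm)
    have hmW : m < finrank F W := hm
    have hWn : finrank F W ≤ n := W.finrank_le.trans_eq (finrank_fin_fun F)
    have hmn : m < n := lt_of_lt_of_le hmW hWn
    -- the current basis `Q = P·A` and the pulled-back subspace `W₂ = Q⁻¹ W`
    set Q : GL (Fin n) F := P * Matrix.GeneralLinearGroup.map O.subtype A with hQ
    have hQval : (Q : Matrix (Fin n) (Fin n) F) =
        (P : Matrix (Fin n) (Fin n) F) * (A : Matrix (Fin n) (Fin n) O).map O.subtype := rfl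
    set W₂ : Submodule F (Fin n → F) := W.comap (Matrix.toLin' (Q : Matrix (Fin n) (Fin n) F)) with hW₂
    have hmem₂ : ∀ x, x ∈ W₂ ↔ (Q : Matrix (Fin n) (Fin n) F) *ᵥ x ∈ W := fun x => by
      rw [hW₂, Submodule.mem_comap, Matrix.toLin'_apply]
    have hstd : ∀ j : Fin n, (j : ℕ) < m → (Pi.single j 1 : Fin n → F) ∈ W₂ := fun j hj => by
      rw [hmem₂, hQval]; exact hA j hj
    have hfin : finrank F W₂ = finrank F W := finrank_comap_toLin'_units Q W
    -- a vector of `W₂` with a non-zero coordinate beyond `m`, its first `m` coordinates killed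
    obtain ⟨w, hw₂, i, hi, hwi⟩ :=
      exists_mem_apply_ne_zero_of_lt_finrank hmn.le W₂ (hfin.symm ▸ hmW)
    set w₀ : Fin n → F := fun j => if (j : ℕ) < m then 0 else w j with hw₀
    have hw₀mem : w₀ ∈ W₂ := by
      have hv : w - w₀ ∈ W₂ := mem_of_single_mem W₂ (fun j => (j : ℕ) < m) hstd (w - w₀) fun j hj => by
        simp [hw₀, hj]
      have h2 : w₀ = w - (w - w₀) := (sub_sub_cancel w w₀).symm
      rw [h2]
      exact W₂.sub_mem hw₂ hv
    have hw₀ne : w₀ ≠ 0 := fun h => hwi (by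
      have h1 := congr_fun h i
      simpa [hw₀, not_lt.mpr hi] using h1)
    have hw₀lt : ∀ j : Fin n, (j : ℕ) < m → w₀ j = 0 := fun j hj => by simp [hw₀, hj]
    -- scaled into `Oⁿ` with a unit coordinate `i₀ ≥ m`
    obtain ⟨i₀, hi₀, hint⟩ := exists_inv_mul_mem_valuationSubring O hw₀ne
    have hi₀m : m ≤ (i₀ : ℕ) := not_lt.mp fun h => hi₀ (hw₀lt i₀ h)
    set c : F := (w₀ i₀)⁻¹ with hc
    set w' : Fin n → O := fun j => ⟨c * w₀ j, hint j⟩ with hw'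
    have hw'i₀ : w' i₀ = 1 := Subtype.ext (by
      change c * w₀ i₀ = 1
      rw [hc, inv_mul_cancel₀ hi₀])
    obtain ⟨A₂, hA₂, hA₂fix⟩ := exists_GL_mulVec_single_eq w' i₀ ⟨m, hmn⟩ hw'i₀
    refine ⟨A * A₂, fun j hj => ?_⟩
    have hQ' : (P : Matrix (Fin n) (Fin n) F) *
        ((A * A₂ : GL (Fin n) O) : Matrix (Fin n) (Fin n) O).map O.subtype =
        (Q : Matrix (Fin n) (Fin n) F) * (A₂ : Matrix (Fin n) (Fin n) O).map O.subtype := by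
      rw [Units.val_mul, Matrix.map_mul, ← Matrix.mul_assoc, hQval]
    rw [hQ', ← mulVec_mulVec]
    rcases Nat.lt_succ_iff_lt_or_eq.mp hj with hj | hj
    · -- an old column
      have hj1 : j ≠ ⟨m, hmn⟩ := by
        rintro rfl
        exact lt_irrefl _ hj
      have hj2 : j ≠ i₀ := by
        rintro rfl
        omega
      rw [← coe_single O j, map_subtype_mulVec_coe O, hA₂fix j hj1 hj2, coe_single O j]
      exact (hmem₂ _).mp (hstd j hj)
    · -- the new column `c • w₀`
      have hjm : j = ⟨m, hmn⟩ := Fin.ext hj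
      rw [hjm, ← coe_single O ⟨m, hmn⟩, map_subtype_mulVec_coe O, hA₂]
      have h1 : (fun i => ((w' i : O) : F)) = c • w₀ := by
        ext i; simp [hw', Pi.smul_apply, smul_eq_mul]
      rw [h1, mulVec_smul]
      exact W.smul_mem c ((hmem₂ _).mp hw₀mem)

end Summit.Langlands.Langlands.Cruxes.StableYoshidaCongruence.SerreDualRibetSquare

end
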